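import Summits.Ventures.Crystal3D.StickySpheres.FourteenVertexCones
import Summits.Ventures.Crystal3D.Bulk.ThirteenSphereMaximisers
import HarnessLib

/-!
# The five realisable rows of the `(13, 36)` list are the [HC16] clusters g4–g8 (non-vacuity of the T(14) hypothesis)

Venture `Crystal3D` (cell `pub-crystal3d`, seat p1). `FourteenVertexCones.lean` proves `C(14) = 40` from the hypothesis that
the six-row list `L36d4rows` (`FourteenVertexConesBlocks.lean`) is a complete list of the relaxed-realisable 13-vertex graphs
with `36` edges and minimum degree `≥ 4`. This file identifies five of the six rows with the kernel packings of
`Bulk/ThirteenSphereMaximisers.lean` — the integer models `hc13gkInt` of the eight [HC16] 36-contact 13-clusters — and so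
proves that those rows ARE relaxed-realisable (the hypothesis is not vacuous, and the chain's graphs are the maximisers'
contact graphs, with the IDENTITY labelling: the models were built in graph6-canonical vertex order):
row `0` = g6 (`hc13g6Int`, contact at squared distance `162`), row `1` = g5 (`hc13g5Int`, `2`), row `2` = g4 (`hc13g4Int`,
`1458`), row `3` = g7 (`hc13g7Int`, `18`; centred anticuboctahedral = hcp shell), row `5` = g8 (`hc13g8Int`, `18`; centred
cuboctahedral = fcc shell). Row `4` (`Luk?GLDGqhDQ~~`) is the chain's CARRIED graph: no realisation is claimed (the cell's
engines refute it ×3; nothing in the kernel). The clusters g1–g3 of [HC16] have a vertex of degree `3` and do not belong to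
the minimum-degree-4 list. Screen: p1-g5 folder `work/conecert14/isos14.py`.
HONEST FRAMING: explicit finite configurations checked by `decide`; standard axioms; nothing here is a completeness claim.
-/

namespace Summit.Ventures.Crystal3D

open Finset SimpleGraph
open Literature.Geometry.DiscreteGeometry (sqNormInt)

/-- Row `0` of `L36d4rows` (`L?iYbEgW[hIRN~`) is the contact graph of the [HC16] cluster g6 (`hc13g6Int`, contacts at
integer squared distance `162`, identity labelling); in particular it is relaxed-realisable. [folklore] -/
theorem relaxedRealisable_L36d4_row0 : RelaxedRealisable (tableGraph 13 (L36d4rows.getD 0 [])) := by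
  rw [tableGraph_eq (by decide +kernel) (by decide +kernel)]
  exact relaxedRealisable_boolGraph_of_intConfig _ _ _ hc13g6Int (m := 162) (by norm_num) (by decide +kernel) sep_hc13g6

/-- Row `1` of `L36d4rows` (`LCd@IgisTPkrF~`) is the contact graph of the [HC16] cluster g5 (`hc13g5Int`, squared
distance `2`); relaxed-realisable. [folklore] -/
theorem relaxedRealisable_L36d4_row1 : RelaxedRealisable (tableGraph 13 (L36d4rows.getD 1 [])) := by
  rw [tableGraph_eq (by decide +kernel) (by decide +kernel)]
  exact relaxedRealisable_boolGraph_of_intConfig _ _ _ hc13g5Int (m := 2) (by norm_num) (by decide +kernel) sep_hc13g5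

/-- Row `2` of `L36d4rows` (`L_`?omgXHtEjr~`) is the contact graph of the [HC16] cluster g4 (`hc13g4Int`, squared
distance `1458`); relaxed-realisable. [folklore] -/
theorem relaxedRealisable_L36d4_row2 : RelaxedRealisable (tableGraph 13 (L36d4rows.getD 2 [])) := by
  rw [tableGraph_eq (by decide +kernel) (by decide +kernel)]
  exact relaxedRealisable_boolGraph_of_intConfig _ _ _ hc13g4Int (m := 1458) (by norm_num) (by decide +kernel)
    sep_hc13g4

/-- Row `3` of `L36d4rows` (`Lsk?XKUPBAiE~~`) is the contact graph of the centred anticuboctahedral cluster g7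
(`hc13g7Int`, squared distance `18`; the hcp first shell); relaxed-realisable. [folklore] -/
theorem relaxedRealisable_L36d4_row3 : RelaxedRealisable (tableGraph 13 (L36d4rows.getD 3 [])) := by
  rw [tableGraph_eq (by decide +kernel) (by decide +kernel)]
  exact relaxedRealisable_boolGraph_of_intConfig _ _ _ hc13g7Int (m := 18) (by norm_num) (by decide +kernel) sep_hc13g7

/-- Row `5` of `L36d4rows` (`L{cAGgeBQSeK~~`) is the contact graph of the centred cuboctahedral cluster g8 (`hc13g8Int`,
squared distance `18`; the fcc first shell); relaxed-realisable. [folklore] -/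
theorem relaxedRealisable_L36d4_row5 : RelaxedRealisable (tableGraph 13 (L36d4rows.getD 5 [])) := by
  rw [tableGraph_eq (by decide +kernel) (by decide +kernel)]
  exact relaxedRealisable_boolGraph_of_intConfig _ _ _ hc13g8Int (m := 18) (by norm_num) (by decide +kernel) sep_hc13g8

/-- **Non-vacuity of the T(14) hypothesis list:** every row of `L36d4rows` except the carried row `4` is
relaxed-realisable (rows `0, 1, 2, 3, 5` = [HC16] g6, g5, g4, g7, g8). [folklore] -/
theorem relaxedRealisable_L36d4_of_ne_four {k : ℕ} (hk : k < 6) (h4 : k ≠ 4) :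
    RelaxedRealisable (tableGraph 13 (L36d4rows.getD k [])) := by
  interval_cases k
  · exact relaxedRealisable_L36d4_row0
  · exact relaxedRealisable_L36d4_row1
  · exact relaxedRealisable_L36d4_row2
  · exact relaxedRealisable_L36d4_row3
  · exact absurd rfl h4
  · exact relaxedRealisable_L36d4_row5

end Summit.Ventures.Crystal3D
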